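import Summits.BirchSwinnertonDyer.BirchSwinnertonDyer.Theorems.BiquadraticEisensteinDescentDisjointDivisibilityDefs
import Mathlib.Analysis.SpecialFunctions.Log.Basic
import Mathlib.Algebra.Order.BigOperators.Ring.Finset
import HarnessLib

set_option linter.dupNamespace false -- `Summit.BirchSwinnertonDyer.BirchSwinnertonDyer.Theorems.…` (summit = sub)
set_option autoImplicit false

/-!
# Route `BiquadraticEisensteinDescent`, crux `HeegnerTwistCouplingInSupply` (stmt-BirchSwinnertonDyer-21381) —
# crux idea `disjoint-divisibility-pigeonhole`: the MOMENT ROUTE to the L-side input S1 (Cauchy–Schwarz), kernel form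

Cell `pub/bsd-wall`, width-prover seat `bsd-wall-cm-bed-w4` g24 (explicit-unit, `--supports stmt-BirchSwinnertonDyer-21381`
as helper). Objects in `…DisjointDivisibilityDefs.lean`. The card (Cruxes/HeegnerTwistCouplingInSupply/Ideas/
disjoint-divisibility-pigeonhole.md) proposes to obtain its L-side input S1 = `LevelUniformNonvanishingCount A B` («at every
height `Y ≥ N_W^A` at least a `(log Y)^{-B}`-fraction of the Heegner discriminants for `N_W` below `Y` are non-vanishing
twists») from a level-uniform FIRST MOMENT lower bound and a level-uniform sharp SECOND MOMENT upper bound for the central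
values `|L(W^{(d)}, 1)|` over the Heegner family, «by Cauchy–Schwarz». This file is exactly that step, as a kernel theorem:

* **`levelUniformNonvanishingCount_of_moments`** — if for every CM curve `W` of analytic rank one and every `Y ≥ N_W^A`
  (M1) `Σ_{d ∈ A_{N_W}(Y)} |L(W^{(d)},1)| ≥ c₁·#A_{N_W}(Y)` and (M2) `Σ_{d ∈ A_{N_W}(Y)} |L(W^{(d)},1)|² ≤ c₂·#A_{N_W}(Y)·(log Y)^B`
  with `0 < c₁` and `c₂ ≤ c₁²`, then S1(`A, B`) holds: `#{d : L ≠ 0}·Σ|L|² ≥ (Σ|L|)²` (Mathlib `Finset.sum_mul_sq_le_sq_mul_sq`).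
  The normalisation `c₂ ≤ c₁²` is free in applications (enlarge `B` by one and `A` so that `log Y ≥ c₂/c₁²`).

Nothing here asserts M1 or M2 (first moments with power saving and polynomial level dependence are in print — Iwaniec 1990,
Hoffstein–Kontorovich 2010; a level-uniform sharp second moment over a Heegner family is NOT — Soundararajan–Young under GRH,
X. Li 2024 at level one); `|L(W^{(d)},1)|` is the norm of the tree's `(W.quadraticTwist d).entireLFunction 1`, as in the crux.
BSD is not proved; stmt-21381 is not closed.
-/

noncomputable section

open scoped Classical

open Literature.NumberTheory.EllipticCurves

namespace Summit.BirchSwinnertonDyer.BirchSwinnertonDyer.Theorems.DisjointDivisibility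

/-- **Cauchy–Schwarz on a family**: for a finset `s` and `f ≥ 0` (pointwise irrelevant — any real `f`),
`(Σ_{s} f)² ≤ #{i ∈ s : f i ≠ 0} · Σ_{s} f²`. [folklore] -/
theorem sq_sum_le_card_filter_ne_zero_mul_sum_sq {ι : Type*} (s : Finset ι) (f : ι → ℝ) :
    (∑ i ∈ s, f i) ^ 2 ≤ ((s.filter (fun i => f i ≠ 0)).card : ℝ) * ∑ i ∈ s, f i ^ 2 := by
  set g : ι → ℝ := fun i => if f i ≠ 0 then 1 else 0 with hg
  have hfg : ∀ i, f i * g i = f i := by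
    intro i
    by_cases h : f i ≠ 0
    · simp [hg, h]
    · push Not at h
      simp [hg, h]
  have hgg : ∑ i ∈ s, g i ^ 2 = ((s.filter (fun i => f i ≠ 0)).card : ℝ) := by
    rw [Finset.card_filter]
    push_cast
    refine Finset.sum_congr rfl fun i _ => ?_
    by_cases h : f i ≠ 0
    · simp [hg, h]
    · push Not at h
      simp [hg, h]
  have hCS := Finset.sum_mul_sq_le_sq_mul_sq s f g
  simp_rw [hfg] at hCS
  rw [hgg] at hCS
  linarith

/-- **S1 from the two moments (the card's «moment route», kernel form).** Level-uniform first-moment lower bound (M1, constant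
`c₁ > 0`) and second-moment upper bound (M2, constant `c₂ ≤ c₁²`, loss `(log Y)^B`) over the Heegner family `A_{N_W}(Y)` of every
CM curve `W` of analytic rank one, at every height `Y ≥ N_W^A`, imply `LevelUniformNonvanishingCount A B`, by
`#{L ≠ 0} ≥ (Σ|L|)²/Σ|L|²`. M1, M2 are hypotheses; nothing is asserted about them. [folklore] -/
theorem levelUniformNonvanishingCount_of_moments {A B : ℕ} {c₁ c₂ : ℝ} (hc₁ : 0 < c₁) (hc : c₂ ≤ c₁ ^ 2)
    (hM1 : ∀ (W : WeierstrassCurve ℚ) [W.IsElliptic] [W.IsGloballyMinimal] [NeZero (W.conductorNorm ℤ)],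
      W.HasCM → W.analyticRank = 1 → ∀ Y : ℕ, (W.conductorNorm ℤ) ^ A ≤ Y →
        c₁ * ((ambient (W.conductorNorm ℤ) Y).card : ℝ) ≤
          ∑ d ∈ ambient (W.conductorNorm ℤ) Y, ‖(W.quadraticTwist (d : ℚ)).entireLFunction 1‖)
    (hM2 : ∀ (W : WeierstrassCurve ℚ) [W.IsElliptic] [W.IsGloballyMinimal] [NeZero (W.conductorNorm ℤ)],
      W.HasCM → W.analyticRank = 1 → ∀ Y : ℕ, (W.conductorNorm ℤ) ^ A ≤ Y →
        ∑ d ∈ ambient (W.conductorNorm ℤ) Y, ‖(W.quadraticTwist (d : ℚ)).entireLFunction 1‖ ^ 2 ≤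
          c₂ * ((ambient (W.conductorNorm ℤ) Y).card : ℝ) * (Real.log Y) ^ B) :
    LevelUniformNonvanishingCount A B := by
  intro W _ _ _ hCM hr Y hY
  have h1 := hM1 W hCM hr Y hY
  have h2 := hM2 W hCM hr Y hY
  set a : ℝ := ((ambient (W.conductorNorm ℤ) Y).card : ℝ) with ha
  set S : ℝ := ∑ d ∈ ambient (W.conductorNorm ℤ) Y, ‖(W.quadraticTwist (d : ℚ)).entireLFunction 1‖ with hS
  set S2 : ℝ := ∑ d ∈ ambient (W.conductorNorm ℤ) Y, ‖(W.quadraticTwist (d : ℚ)).entireLFunction 1‖ ^ 2 with hS2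
  set n : ℝ := ((nonvanishingIn W (W.conductorNorm ℤ) Y).card : ℝ) with hn
  set LB : ℝ := (Real.log Y) ^ B with hLB
  have ha0 : 0 ≤ a := Nat.cast_nonneg _
  have hn0 : 0 ≤ n := Nat.cast_nonneg _
  have hLB0 : 0 ≤ LB := pow_nonneg (Real.log_natCast_nonneg Y) B
  -- Cauchy–Schwarz: `S² ≤ n · S2`
  have hCS : S ^ 2 ≤ n * S2 := by
    have h := sq_sum_le_card_filter_ne_zero_mul_sum_sq (ambient (W.conductorNorm ℤ) Y)
      (fun d : ℤ => ‖(W.quadraticTwist (d : ℚ)).entireLFunction 1‖)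
    have hfilter : ((ambient (W.conductorNorm ℤ) Y).filter
        (fun d : ℤ => ‖(W.quadraticTwist (d : ℚ)).entireLFunction 1‖ ≠ 0)) =
        nonvanishingIn W (W.conductorNorm ℤ) Y := by
      rw [nonvanishingIn]
      refine Finset.filter_congr fun d _ => ?_
      rw [norm_ne_zero_iff]
    rw [hfilter] at h
    exact h
  -- degenerate height: `(log Y)^B = 0`
  rcases hLB0.eq_or_lt with hLB00 | hLBpos
  · rw [← hLB00]
    simp [hn0]
  rw [div_le_iff₀ hLBpos]
  -- `c₁² a² ≤ S² ≤ n S2 ≤ n c₂ a LB ≤ n c₁² a LB`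
  have hSge : c₁ * a ≤ S := h1
  have hsq : (c₁ * a) ^ 2 ≤ S ^ 2 := pow_le_pow_left₀ (by positivity) hSge 2
  have h3 : n * S2 ≤ n * (c₂ * a * LB) := mul_le_mul_of_nonneg_left h2 hn0
  have h4 : n * (c₂ * a * LB) ≤ n * (c₁ ^ 2 * a * LB) := by
    have : c₂ * a * LB ≤ c₁ ^ 2 * a * LB := by
      have := mul_le_mul_of_nonneg_right (mul_le_mul_of_nonneg_right hc ha0) hLB0
      linarith
    exact mul_le_mul_of_nonneg_left this hn0
  have hchain : c₁ ^ 2 * a * a ≤ c₁ ^ 2 * a * (n * LB) := by nlinarith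
  rcases ha0.eq_or_lt with ha00 | hapos
  · rw [← ha00]; positivity
  · have hc1a : 0 < c₁ ^ 2 * a := by positivity
    exact le_of_mul_le_mul_left hchain hc1a

end Summit.BirchSwinnertonDyer.BirchSwinnertonDyer.Theorems.DisjointDivisibility

end
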